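import Summits.QuantumFields.YangMills.Theorems.BalabanUVNodesK2V6Defs
import Mathlib.Analysis.Normed.Group.Tannery

/-!
# Idea-5 g8 sketch — «two-bound activity interpolation» (Tannery modulus at FIXED threshold) for crux K2⁷
# `EndpointGivenBR13SepCoPH` (stmt-QuantumFields-20543), stub 2ᴮ″ `RunRemAtSomeJets` of skeleton v6 (5a75a2378c79b303)

Cell `ym-nodeO-ideate`, IDEATOR seat `ym-nodeO-idea-5` gen 8 (planner-ym-nodeO-idea-5-g8-0), lens «obstruction-first».
Companion of the crux idea card `Ideas/two-bound-activity-interpolation.md` (filed `ledger idea add --crux stmt-QuantumFields-20543`).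

HONEST FRAMING.  Nothing here proves the Yang–Mills mass gap (Clay) or any rung of it.  Route R4 `BalabanUVNodes` closes only the
CONDITIONAL finite-𝕋⁴ rung `BalabanLadder.UV`; NODE O = [Balaban1987RG1] Thm 2 ∕ (0.31) p. 259 is UNPROVED in print; K2⁷ stays OPEN.
What is PROVED below is elementary real analysis (an ENGINE) plus by-name bookkeeping (a ROAD into the registered stub text); what is
DEFINED below (`RunDominatedSplit`, `DominatedSplitAtAnchoredJets13`, `AnchorSurvSomeJets13`) are HYPOTHESIS SHAPES — obligation texts a
fibre-level supplier must discharge from print's expansions ([I] (2.12)–(2.14) p. 268, [II] §2 (2.38) p. 20); none is asserted.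

THE MECHANISM (one sentence).  If along the in-window RG runs the remainder `β_{k+1}(g_0,…,g_k) − θ.cβ·b_k` is a convergent SUM of
localized pieces `I_X`, each obeying TWO SEPARATELY ELEMENTARY bounds — print's FROZEN majorant `|I_X| ≤ M_X` (k-, history- and
coupling-free, SUMMABLE: (2.38) `O(1)C₃ε₁e^{−κ′d(X)}`) and a CRUDE VANISHING majorant `|I_X| ≤ A_X · g_k` (k- and history-free but NOT
summable: `A_X ≲ e^{c|X|}`; source: (2.13) «the expression under the exponential above vanishes at g_k = 0») — then
`|β_{k+1} − θ.cβ·b_k| ≤ ω(g_k)`, `ω(g) := Σ_X min(A_X g, M_X) → 0` as `g → 0⁺` by TANNERY's theorem (dominated convergence over the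
polymer index), uniformly in k and in the history; and a modulus with NO RATE is all the registered consumer needs (every cap `s > 0`
is met on a small enough window `]0, γ₁]`, no seam `ε₁·K_rem ≤ θ.cβ·stepBal`).

CONTENTS.  §1 ENGINE (proved): `omegaMin`, `tendsto_omegaMin` (Tannery), `abs_tsum_le_omegaMin`.  §2 LETTER (hypothesis shape) `RunDominatedSplit`
+ PROVED roads `runModulus_of_runDominatedSplit`, `runConstRemainder_of_runModulus` (ANY cap `s > 0` at some level `γ₁ ≤ γ₀`).  §3 SOCKET at the
record (hypothesis shapes `DominatedSplitAtAnchoredJets13`, `AnchorSurvSomeJets13` = the N17 road's `hAS` text verbatim) + PROVED ★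
`runRemAtSomeJets_of_dominatedSplit_anchorSurv : … → RunRemAtSomeJets` (the registered stub text BY NAME, p603331) + ★★ the composition to the
crux decl BY NAME through `EndpointGivenBR13SepCoPH_of_stubTexts`.  §4 sanity: the ONE-TERM split is exactly the linear (P1) road
(`runDominatedSplit_of_linear`), so the letter GENERALISES RemainderChain §2 (b) and gains exactly when `Σ A_X = ∞`.

Sources: [I] = [Balaban1987RG1] CMP 109 (1987) (2.12)–(2.15) p. 268, (1.20)–(1.22) p. 264, (0.29) p. 258; [II] = [Balaban1988RG2Cluster] CMP 119 (1988)
Lemma 3 (2.38) p. 20, (2.41) p. 21, p. 8 («use g_k|B| instead of ε₁»); tree: `Beta.RemainderChain` §1–§2 (the frozen chain and the located gap «ω(γ₀) → 0 at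
FIXED ε₁ … not carried out in print»), p596574 `…K2NamedJetsRunRemAt`, p588621 `…K2JsOfRecord`, p603331 `…K2V6Defs`; Mathlib `tendsto_tsum_of_dominated_convergence`.
-/

noncomputable section

namespace Summit.QuantumFields.YangMills.Cruxes.EndpointGivenBR13SepCoPH.Idea5g8

open Filter Topology
open Literature.MathematicalPhysics.QuantumFieldTheory.Balaban1983to89
open Literature.MathematicalPhysics.QuantumFieldTheory.Balaban1983to89.FlowStep
open Literature.MathematicalPhysics.QuantumFieldTheory.Balaban1983to89.T4Continuum (T4Family)
open Literature.MathematicalPhysics.QuantumFieldTheory.Balaban1983to89.Beta.Drift (OneLoopDrift)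
open Summit.QuantumFields.YangMills.Theorems.BalabanUVNodesK2JsOfRecord (StepColourData beta0OfJs stepBal_L_pos)
open Summit.QuantumFields.YangMills.Theorems.BalabanUVNodesK2NamedJetsRemAt (ScaleAnchor)
open Summit.QuantumFields.YangMills.Theorems.BalabanUVNodesK2NamedJetsRunRemAt (RunRemAt RunConstRemainder SurvCont)
open Summit.QuantumFields.YangMills.Theorems.BalabanUVNodesK2V6Defs (Window13 RunRemAtSomeJets D1AtAnchoredJets
  EndpointGivenBR13SepCoPH_of_stubTexts)

/-! ## §1 ENGINE — the Tannery modulus `ω(g) = Σ' min(A_i g, M_i)` (pure real analysis, PROVED) -/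

variable {ι : Type*}

/-- The two-bound interpolation modulus `ω(g) := Σ'_i min(A_i·g, M_i)`. [folklore] -/
def omegaMin (A M : ι → ℝ) (g : ℝ) : ℝ := ∑' i, min (A i * g) (M i)

theorem min_nonneg_of {A M : ι → ℝ} (hA : ∀ i, 0 ≤ A i) (hM : ∀ i, 0 ≤ M i) {g : ℝ} (hg : 0 ≤ g) (i : ι) :
    0 ≤ min (A i * g) (M i) :=
  le_min (mul_nonneg (hA i) hg) (hM i)

theorem summable_min {A M : ι → ℝ} (hA : ∀ i, 0 ≤ A i) (hM : ∀ i, 0 ≤ M i) (hsum : Summable M) {g : ℝ}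
    (hg : 0 ≤ g) : Summable (fun i => min (A i * g) (M i)) :=
  hsum.of_nonneg_of_le (fun i => min_nonneg_of hA hM hg i) (fun _ => min_le_right _ _)

theorem omegaMin_nonneg {A M : ι → ℝ} (hA : ∀ i, 0 ≤ A i) (hM : ∀ i, 0 ≤ M i) {g : ℝ} (hg : 0 ≤ g) :
    0 ≤ omegaMin A M g :=
  tsum_nonneg (fun i => min_nonneg_of hA hM hg i)

/-- `ω` is monotone on `[0, ∞)`. [folklore] -/
theorem omegaMin_mono {A M : ι → ℝ} (hA : ∀ i, 0 ≤ A i) (hM : ∀ i, 0 ≤ M i) (hsum : Summable M) {g g' : ℝ}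
    (hg : 0 ≤ g) (hgg' : g ≤ g') : omegaMin A M g ≤ omegaMin A M g' :=
  (summable_min hA hM hsum hg).tsum_le_tsum
    (fun i => min_le_min (mul_le_mul_of_nonneg_left hgg' (hA i)) le_rfl)
    (summable_min hA hM hsum (hg.trans hgg'))

/-- `ω ≤ Σ M` (the frozen bound is never lost). [folklore] -/
theorem omegaMin_le_tsum {A M : ι → ℝ} (hA : ∀ i, 0 ≤ A i) (hM : ∀ i, 0 ≤ M i) (hsum : Summable M) {g : ℝ}
    (hg : 0 ≤ g) : omegaMin A M g ≤ ∑' i, M i :=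
  (summable_min hA hM hsum hg).tsum_le_tsum (fun _ => min_le_right _ _) hsum

/-- **THE ENGINE (Tannery): `ω(g) → 0` as `g → 0⁺`** — summable frozen majorants + termwise vanishing, NO rate and NO
summability asked of the vanishing constants `A_i`. [folklore] -/
theorem tendsto_omegaMin {A M : ι → ℝ} (hA : ∀ i, 0 ≤ A i) (hM : ∀ i, 0 ≤ M i) (hsum : Summable M) :
    Tendsto (omegaMin A M) (𝓝[>] 0) (𝓝 0) := by
  have hlim : ∀ i, Tendsto (fun g : ℝ => min (A i * g) (M i)) (𝓝[>] 0) (𝓝 (min (A i * 0) (M i))) := by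
    intro i
    have hc : Continuous fun g : ℝ => min (A i * g) (M i) :=
      (continuous_const.mul continuous_id).min continuous_const
    exact (hc.tendsto 0).mono_left nhdsWithin_le_nhds
  have hbd : ∀ᶠ g in 𝓝[>] (0 : ℝ), ∀ i, ‖min (A i * g) (M i)‖ ≤ M i := by
    filter_upwards [self_mem_nhdsWithin] with g hg
    intro i
    rw [Real.norm_eq_abs, abs_of_nonneg (min_nonneg_of hA hM (le_of_lt hg) i)]
    exact min_le_right _ _
  have h := tendsto_tsum_of_dominated_convergence hsum hlim hbd
  have h0 : (fun i => min (A i * 0) (M i)) = fun _ => (0 : ℝ) := by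
    funext i
    rw [mul_zero]
    exact min_eq_left (hM i)
  rw [h0, tsum_zero] at h
  exact h

/-- **THE TERMWISE-TO-SUM STEP**: a convergent sum whose terms obey BOTH bounds is bounded by `ω`. [folklore] -/
theorem abs_tsum_le_omegaMin {A M : ι → ℝ} {I : ι → ℝ} {g : ℝ} (hsum : Summable M)
    (hIM : ∀ i, |I i| ≤ M i) (hIA : ∀ i, |I i| ≤ A i * g) : |∑' i, I i| ≤ omegaMin A M g := by
  have hIs : Summable (fun i => |I i|) := hsum.of_nonneg_of_le (fun i => abs_nonneg _) hIM
  have hIn : Summable (fun i => ‖I i‖) := by simpa [Real.norm_eq_abs] using hIs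
  have hmin : Summable (fun i => min (A i * g) (M i)) :=
    hsum.of_nonneg_of_le (fun i => (abs_nonneg _).trans (le_min (hIA i) (hIM i))) (fun i => min_le_right _ _)
  calc |∑' i, I i| = ‖∑' i, I i‖ := (Real.norm_eq_abs _).symm
    _ ≤ ∑' i, ‖I i‖ := norm_tsum_le_tsum_norm hIn
    _ = ∑' i, |I i| := by simp [Real.norm_eq_abs]
    _ ≤ omegaMin A M g := hIs.tsum_le_tsum (fun i => le_min (hIA i) (hIM i)) hmin

/-! ## §2 LETTER — the activity-resolved DOMINATED SPLIT of the remainder along in-window runs (hypothesis SHAPE), and its roads -/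

/-- **`RunDominatedSplit β b γ₀` (hypothesis shape, run-keyed as every K2 letter since BN-F).**  Along every in-window solution of (0.20)
(`RGEqH`, `Step.InInterval γ₀`), at every prefix, the remainder `β_{k+1}(g_0,…,g_k) − b_k` is the sum of a family of localized pieces
`I_i` indexed by a type `ι` (print: polymers `X ∋ 0` of the unit lattice), each obeying the FROZEN bound `|I_i| ≤ M_i` with `Σ M_i < ∞`
([II] (2.38) + the tree sum) AND the CRUDE VANISHING bound `|I_i| ≤ A_i · g_k` ([I] (2.13) «vanishes at g_k = 0», termwise; `A_i`
finite, no summability).  Obligation text for a fibre-level supplier; never a fact. [cite: Balaban1988RG2Cluster, (2.38) p.20; Balaban1987RG1, (2.13) p.268] -/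
def RunDominatedSplit (β : HBeta) (b : ℕ → ℝ) (γ₀ : ℝ) : Prop :=
  ∃ (ι : Type) (I : ι → (k : ℕ) → (Fin (k + 1) → ℝ) → ℝ) (A M : ι → ℝ),
    (∀ i, 0 ≤ A i) ∧ (∀ i, 0 ≤ M i) ∧ Summable M ∧
    ∀ (n : ℕ) (gs : ℕ → ℝ), RGEqH n β gs → Step.InInterval γ₀ n gs → ∀ k, k ≤ n →
      HasSum (fun i => I i k (prefixOf gs k)) (β k (prefixOf gs k) - b k) ∧
      ∀ i, |I i k (prefixOf gs k)| ≤ M i ∧ |I i k (prefixOf gs k)| ≤ A i * gs k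

/-- **LETTER ⟹ RUN MODULUS (proved)**: a dominated split gives ONE function `ω → 0` at `0⁺` bounding the remainder by `ω(g_k)` at every
prefix of every in-window run — the vertex modulus NODE O asks for, with NO rate. [folklore] -/
theorem runModulus_of_runDominatedSplit {β : HBeta} {b : ℕ → ℝ} {γ₀ : ℝ} (h : RunDominatedSplit β b γ₀) :
    ∃ ω : ℝ → ℝ, Tendsto ω (𝓝[>] 0) (𝓝 0) ∧
      ∀ (n : ℕ) (gs : ℕ → ℝ), RGEqH n β gs → Step.InInterval γ₀ n gs → ∀ k, k ≤ n →
        |β k (prefixOf gs k) - b k| ≤ ω (gs k) := by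
  obtain ⟨ι, I, A, M, hA, hM, hsum, hrun⟩ := h
  refine ⟨omegaMin A M, tendsto_omegaMin hA hM hsum, ?_⟩
  intro n gs hrg hI k hk
  obtain ⟨hhs, hbd⟩ := hrun n gs hrg hI k hk
  rw [← hhs.tsum_eq]
  exact abs_tsum_le_omegaMin hsum (fun i => (hbd i).1) (fun i => (hbd i).2)

/-- **RUN MODULUS ⟹ CONSTANT REMAINDER WITH ANY CAP (proved)**: if `ω → 0` at `0⁺` bounds the remainder along the `]0,γ₀]`-runs, then for
EVERY `s > 0` there is a level `0 < γ₁ ≤ γ₀` with `RunConstRemainder β b s γ₁` — no seam between print's frozen constant and the cap. [folklore] -/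
theorem runConstRemainder_of_runModulus {β : HBeta} {b : ℕ → ℝ} {γ₀ : ℝ} {ω : ℝ → ℝ}
    (hω : Tendsto ω (𝓝[>] 0) (𝓝 0))
    (hrun : ∀ (n : ℕ) (gs : ℕ → ℝ), RGEqH n β gs → Step.InInterval γ₀ n gs → ∀ k, k ≤ n →
      |β k (prefixOf gs k) - b k| ≤ ω (gs k))
    (hγ₀ : 0 < γ₀) {s : ℝ} (hs : 0 < s) :
    ∃ γ₁ : ℝ, 0 < γ₁ ∧ γ₁ ≤ γ₀ ∧ RunConstRemainder β b s γ₁ := by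
  have hev : ∀ᶠ g in 𝓝[>] (0 : ℝ), ω g < s := (tendsto_order.1 hω).2 s hs
  obtain ⟨u, hu, hsub⟩ := mem_nhdsGT_iff_exists_Ioo_subset.1 hev
  have hu0 : (0 : ℝ) < u := hu
  refine ⟨min γ₀ (u / 2), lt_min hγ₀ (half_pos hu0), min_le_left _ _, ?_⟩
  intro n gs hrg hI k hk
  have hI₀ : Step.InInterval γ₀ n gs := fun j hj => ⟨(hI j hj).1, (hI j hj).2.trans (min_le_left _ _)⟩
  have hmem : gs k ∈ Set.Ioo 0 u :=
    ⟨(hI k hk).1, lt_of_le_of_lt ((hI k hk).2.trans (min_le_right _ _)) (half_lt_self hu0)⟩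
  have hlt : ω (gs k) < s := hsub hmem
  exact (hrun n gs hrg hI₀ k hk).trans hlt.le

/-- The two roads composed: LETTER ⟹ constant remainder with any positive cap at some level. [folklore] -/
theorem runConstRemainder_of_runDominatedSplit {β : HBeta} {b : ℕ → ℝ} {γ₀ : ℝ} (h : RunDominatedSplit β b γ₀)
    (hγ₀ : 0 < γ₀) {s : ℝ} (hs : 0 < s) :
    ∃ γ₁ : ℝ, 0 < γ₁ ∧ γ₁ ≤ γ₀ ∧ RunConstRemainder β b s γ₁ := by
  obtain ⟨ω, hω, hrun⟩ := runModulus_of_runDominatedSplit h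
  exact runConstRemainder_of_runModulus hω hrun hγ₀ hs

/-! ## §3 SOCKET at the record — hypothesis texts keyed exactly as v6 (κ after θ, c = θ.cβ, anchor-keyed, run-keyed) and the ★ roads BY NAME -/

/-- **(DS) THE SUPPLIER TEXT (hypothesis shape)** — «dominated split at the anchoring named jets»: at a tuple carrying the crux's hypotheses,
for every colour datum whose `θ.cβ`-scaled named one-loop numbers ANCHOR the record's β, the remainder admits a `RunDominatedSplit` on
some window `]0, γ₀]`, `γ₀ ≤ θ.γ`.  Fibre-level content = print's localization of (2.13) with the two per-activity bounds; never a fact. [cite: Balaban1987RG1, (2.13) p.268; Balaban1988RG2Cluster, (2.38) p.20] -/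
def DominatedSplitAtAnchoredJets13 : Prop :=
  ∀ (F : T4Family) (κ : StepColourData) (θ : Node00.Stage13HParams F 2) (hP : θ.Provisos₁₃SepCoPH F 2),
    (θ.ZhUnity F 2 ∧ θ.SlotsNondegenerate₁₃ F 2) → θ.Admissible F 2 →
    B16.EndStatementBPrinted (Node00.datumOfRecord₁₃SepCoPH F 2 θ hP).C → Window13 F θ hP →
    ScaleAnchor (Node00.datumOfRecord₁₃SepCoPH F 2 θ hP).βfun (fun k => θ.cβ * beta0OfJs F κ k) →
    ∃ γ₀ : ℝ, 0 < γ₀ ∧ γ₀ ≤ θ.γ ∧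
      RunDominatedSplit (Node00.datumOfRecord₁₃SepCoPH F 2 θ hP).βfun (fun k => θ.cβ * beta0OfJs F κ k) γ₀

/-- **(AS) THE ANCHOR + SURVIVOR-CONTINUITY TEXT (hypothesis shape)** — VERBATIM the hypothesis `hAS` of the tree road
`…N17RunRemAtOfShiftAnchor.runRemAtSomeJets_of_n17AtRecord13_anchorSurv` (the per-scale identification clause and (C) on survivors at every
level; shared with the N17 and corner roads, not this card's object). [folklore] -/
def AnchorSurvSomeJets13 : Prop :=
  ∀ (F : T4Family) (θ : Node00.Stage13HParams F 2) (hP : θ.Provisos₁₃SepCoPH F 2),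
    (θ.ZhUnity F 2 ∧ θ.SlotsNondegenerate₁₃ F 2) → θ.Admissible F 2 →
    B16.EndStatementBPrinted (Node00.datumOfRecord₁₃SepCoPH F 2 θ hP).C → Window13 F θ hP →
    ∃ κ : StepColourData, ScaleAnchor (Node00.datumOfRecord₁₃SepCoPH F 2 θ hP).βfun (fun k => θ.cβ * beta0OfJs F κ k) ∧
      ∀ γ₀ : ℝ, 0 < γ₀ → γ₀ ≤ θ.γ → SurvCont (Node00.datumOfRecord₁₃SepCoPH F 2 θ hP).βfun γ₀

/-- **★ (DS) + (AS) ⟹ THE REGISTERED STUB TEXT 2ᴮ″ `RunRemAtSomeJets` BY NAME (proved, no sorry).**  Per tuple: κ and the anchor from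
(AS); the dominated split at that κ from (DS); the Tannery modulus gives a run-constant remainder with the cap `s := θ.cβ·stepBal 2 F.L`
itself (positive: `hθ.toStage9.chart.1`, `stepBal_L_pos`) at some level `γ₁ ≤ γ₀ ≤ θ.γ`; (C) at `γ₁` from (AS).  CONDITIONAL on the
two displayed texts; nothing of Bałaban asserted. [cite: Balaban1987RG1, Thm 2 p.259 (first sentence) and (2.13) p.268] -/
theorem runRemAtSomeJets_of_dominatedSplit_anchorSurv (hDS : DominatedSplitAtAnchoredJets13)
    (hAS : AnchorSurvSomeJets13) : RunRemAtSomeJets := by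
  intro F θ hP hU hθ hB hwin
  obtain ⟨κ, hanch, hsc⟩ := hAS F θ hP hU hθ hB hwin
  obtain ⟨γ₀, hγ₀, hγθ, hsplit⟩ := hDS F κ θ hP hU hθ hB hwin hanch
  have hc : 0 < θ.cβ := hθ.toStage9.chart.1
  have hs : 0 < θ.cβ * B12Normalization.stepBal 2 F.L := mul_pos hc (stepBal_L_pos F two_pos)
  obtain ⟨γ₁, hγ₁, hγ₁₀, hrem⟩ := runConstRemainder_of_runDominatedSplit hsplit hγ₀ hs
  exact ⟨κ, γ₁, θ.cβ * B12Normalization.stepBal 2 F.L, hγ₁, hγ₁₀.trans hγθ, le_rfl, hrem, hanch,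
    hsc γ₁ hγ₁ (hγ₁₀.trans hγθ)⟩

/-- **★★ THE COMPOSITION TO THE CRUX DECL BY NAME (proved, no sorry)**: (D1) stub text 1ᴬ + (DS) + (AS) ⟹
`Summit.QuantumFields.YangMills.Theses.BalabanUVNodes.EndpointGivenBR13SepCoPH`, through the tree's `EndpointGivenBR13SepCoPH_of_stubTexts`
(p603331).  CONDITIONAL on three displayed hypothesis texts; K2⁷ NOT closed. [cite: Balaban1987RG1, Thm 2 p.259 (first sentence)] -/
theorem EndpointGivenBR13SepCoPH_of_d1_dominatedSplit_anchorSurv (h₁ : D1AtAnchoredJets)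
    (hDS : DominatedSplitAtAnchoredJets13) (hAS : AnchorSurvSomeJets13) :
    Summit.QuantumFields.YangMills.Theses.BalabanUVNodes.EndpointGivenBR13SepCoPH :=
  EndpointGivenBR13SepCoPH_of_stubTexts h₁ (runRemAtSomeJets_of_dominatedSplit_anchorSurv hDS hAS)

/-! ## §4 Sanity — the ONE-TERM split is the linear (P1) road; the letter is not vacuous -/

/-- A LINEAR run-wise remainder bound `|β_{k+1} − b_k| ≤ C·g_k` (RemainderChain §2 (b), the (P1) road) together with ANY frozen constant
`|β_{k+1} − b_k| ≤ r` IS a one-term dominated split (`ι = Unit`).  So `RunDominatedSplit` generalises the printed-chain roads; its gain is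
exactly the case `Σ A_i = ∞` of countably many activities. [folklore] -/
theorem runDominatedSplit_of_linear {β : HBeta} {b : ℕ → ℝ} {γ₀ C r : ℝ} (hC : 0 ≤ C) (hr : 0 ≤ r)
    (hlin : ∀ (n : ℕ) (gs : ℕ → ℝ), RGEqH n β gs → Step.InInterval γ₀ n gs → ∀ k, k ≤ n →
      |β k (prefixOf gs k) - b k| ≤ C * gs k)
    (hconst : RunConstRemainder β b r γ₀) : RunDominatedSplit β b γ₀ := by
  refine ⟨Unit, fun _ k p => β k p - b k, fun _ => C, fun _ => r, fun _ => hC, fun _ => hr, ?_, ?_⟩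
  · exact (hasSum_fintype fun _ : Unit => r).summable
  · intro n gs hrg hI k hk
    refine ⟨?_, fun _ => ⟨hconst n gs hrg hI k hk, hlin n gs hrg hI k hk⟩⟩
    simp

/-- The EMPTY split forces `β = b` on the runs (so the letter is not trivially inhabited by an empty family unless the remainder vanishes). [folklore] -/
theorem eq_of_runDominatedSplit_empty {β : HBeta} {b : ℕ → ℝ}
    (I : PEmpty → (k : ℕ) → (Fin (k + 1) → ℝ) → ℝ) {gs : ℕ → ℝ} {k : ℕ}
    (h : HasSum (fun i => I i k (prefixOf gs k)) (β k (prefixOf gs k) - b k)) :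
    β k (prefixOf gs k) = b k := by
  have h0 : HasSum (fun i : PEmpty => I i k (prefixOf gs k)) 0 := by
    simp
  have := h.unique h0
  linarith

end Summit.QuantumFields.YangMills.Cruxes.EndpointGivenBR13SepCoPH.Idea5g8
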